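import Literature.NumberTheory.LFunctions.NewmanProofs
import Literature.NumberTheory.LFunctions.DeBruijnHZeroProofs
import Literature.Analysis.Complex.HadamardGenusZeroProofs
import Literature.Analysis.Complex.DeBruijnStripShift
import HarnessLib

/-!
# Newman's characterisation `H_t has only real zeros ↔ Λ ≤ t` — the discharge

Trunk T-ANT (`Literature/NumberTheory/LFunctions`), companion ("Proofs") file of `Equivalents.lean`,
`DeBruijnNewman.lean` and `DeBruijnStrip.lean`. It closes the programme of `EquivalentsProofs.lean`:
there, Newman's characterisation `Literature.NumberTheory.LFunctions.hasOnlyRealZeros_deBruijnH_iff_deBruijnNewmanConst_le`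
(C. M. Newman, *Fourier transforms with only real zeros*, Proc. AMS 61 (1976), **Thm. 3**) was
reduced to exactly three named facts
(`hasOnlyRealZeros_deBruijnH_iff_deBruijnNewmanConst_le_of_newman_of_strip`):

1. `Literature.NumberTheory.LFunctions.exists_not_hasOnlyRealZeros_deBruijnH` (Newman 1976, Thm. 3 proper: some `H_t` has a
   non-real zero) — proved in `NewmanProofs.lean` from Hadamard's factorisation in genus zero,
   itself proved in `Literature/Analysis/Complex/HadamardGenusZeroProofs.lean`;
2. `Literature.NumberTheory.LFunctions.deBruijnH_zero_eq` (`H_0 = ξ(½ + iz/2)/8`, Titchmarsh §10.1) — proved in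
   `DeBruijnHZeroProofs.lean`;
3. `Literature.NumberTheory.LFunctions.de_bruijn_strip` (de Bruijn 1950, Thm. 13 for the family `H_t`, general strip width `Δ`)
   — **proved here** (`de_bruijn_strip_holds`), from the trigonometric-integral form of Thm. 13
   (`Literature.Analysis.Complex.DeBruijn1950.rootsInStrip_gaussian`, `Literature/Analysis/Complex/DeBruijnStripShift.lean`)
   applied to de Bruijn's kernel `F_t(s) = e^{ts²} Φ(|s|)`, for which
   `∫ F_t(s) e^{izs} ds = 2 H_t(z)` and `F_t(s) e^{λ²s²/2} = F_{t + λ²/2}(s)`.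

(The final theorem cannot live in `EquivalentsProofs.lean` itself: `NewmanProofs.lean` imports it.)

## Contents (all proved)

* `Literature.deBruijnKernel t s = e^{ts²} Φ(|s|)`; `isAdmissible_deBruijnKernel` (de Bruijn's
  hypotheses of Thm. 10 with decay exponent `b = 3`), `trigIntegral_deBruijnKernel`
  (`= 2 H_t`), `deBruijnKernel_mul_gaussian`.
* `Literature.NumberTheory.LFunctions.de_bruijn_strip_holds` — **discharge of `Literature.NumberTheory.LFunctions.de_bruijn_strip`** (de Bruijn 1950, Thm. 13).
* `Literature.NumberTheory.LFunctions.mono_deBruijnH_holds`, `Literature.NumberTheory.LFunctions.hasOnlyRealZeros_deBruijnH_one_half_holds`,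
  `Literature.NumberTheory.LFunctions.exists_not_hasOnlyRealZeros_deBruijnH_holds`, `Literature.NumberTheory.LFunctions.bddBelow_setOf_hasOnlyRealZeros_holds`,
  `Literature.NumberTheory.LFunctions.deBruijnNewmanConst_le_iff_holds` — discharges of the remaining `rh.S28` prelude facts of
  `DeBruijnNewman.lean`.
* `Literature.NumberTheory.LFunctions.hasOnlyRealZeros_deBruijnH_iff_deBruijnNewmanConst_le_holds` — **discharge of Newman's
  characterisation** `∀ t, HasOnlyRealZeros (H_t) ↔ Λ ≤ t` (Newman 1976, Thm. 3).
* `Literature.NumberTheory.LFunctions.riemannHypothesis_iff_hasOnlyRealZeros_deBruijnH_zero_holds`,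
  `Literature.NumberTheory.LFunctions.riemannHypothesis_of_hasOnlyRealZeros_deBruijnH_holds` (route `RiemannHypothesis/DBN`),
  and the classical `Literature.NumberTheory.LFunctions.riemannHypothesis_iff_deBruijnNewmanConst_nonpos` (`RH ↔ Λ ≤ 0`).
* Corollaries: `Literature.NumberTheory.LFunctions.deBruijnNewmanConst_le_of_platt_trudgian`,
  `Literature.NumberTheory.LFunctions.deBruijnNewmanConst_nonneg_of_rodgers_tao`,
  `Literature.NumberTheory.LFunctions.riemannHypothesis_iff_deBruijnNewmanConst_eq_zero_of_rodgers_tao` (the `sInf` forms from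
  the `sInf`-free named facts, as announced in `Equivalents.lean`).

## References

* C. M. Newman, *Fourier transforms with only real zeros*, Proc. AMS 61 (1976), 245–251, Thm. 3.
* N. G. de Bruijn, *The roots of trigonometric integrals*, Duke Math. J. 17 (1950), 197–226,
  Thms. 10, 13.
* B. Rodgers, T. Tao, *The de Bruijn–Newman constant is non-negative*, Forum Math. Pi 8 (2020),
  §1 eq. (1)–(3) (`H_t`, `Φ`, `H_0 = ξ/8`), §2 (the `∫_ℝ` form of `H_t`, `Φ` even).
-/

noncomputable section

open Complex Filter Metric Set Topology MeasureTheory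

namespace Literature.NumberTheory.LFunctions

/-! ## de Bruijn's kernel `F_t(s) = e^{ts²} Φ(|s|)` -/

/-- de Bruijn's kernel for `H_t` as a trigonometric integral over `ℝ`:
`F_t(s) = e^{t s²} Φ(|s|)` (Rodgers–Tao 2020, §2, proof of Lemma 2.1: "as `Φ` is even, we may write
(1) as `H_t(z) = ½ ∫_ℝ e^{tu²} Φ(u) e^{izu} du`"). [cite: RodgersTaoFMP2020, §2] -/
def deBruijnKernel (t : ℝ) (s : ℝ) : ℂ :=
  ((Real.exp (t * s ^ 2) * Newman.evenPhi s : ℝ) : ℂ)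

/-- `F_t` is continuous. [folklore] -/
theorem continuous_deBruijnKernel (t : ℝ) : Continuous (deBruijnKernel t) := by
  unfold deBruijnKernel
  exact Complex.continuous_ofReal.comp ((by fun_prop : Continuous fun s : ℝ ↦ Real.exp (t * s ^ 2)).mul
    Newman.continuous_evenPhi)

/-- `F_t` is even. [folklore] -/
theorem deBruijnKernel_neg (t s : ℝ) : deBruijnKernel t (-s) = deBruijnKernel t s := by
  simp [deBruijnKernel, Newman.evenPhi_neg]

/-- `‖F_t(s)‖ = e^{ts²} Φ(|s|)`. [folklore] -/
theorem norm_deBruijnKernel (t s : ℝ) :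
    ‖deBruijnKernel t s‖ = Real.exp (t * s ^ 2) * Newman.evenPhi s := by
  rw [deBruijnKernel, Complex.norm_real, Real.norm_eq_abs,
    abs_of_nonneg (mul_nonneg (Real.exp_pos _).le (Newman.evenPhi_nonneg s))]

/-- The exponent bound behind the decay of `F_t`: for `u ≥ 0`,
`t u² + 9u − π e^{4u} ≤ K − u − u³` for a constant `K = K(t)`. [folklore] -/
theorem exists_deBruijnKernel_exponent_le (t : ℝ) :
    ∃ K : ℝ, ∀ u : ℝ, 0 ≤ u → t * u ^ 2 + 9 * u - Real.pi * Real.exp (4 * u) ≤ K - u - u ^ 3 := by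
  set R₀ : ℝ := |t| + 12 with hR₀
  have hR₀1 : 1 ≤ R₀ := by have := abs_nonneg t; linarith
  refine ⟨|t| * R₀ ^ 2 + 10 * R₀ + R₀ ^ 3, fun u hu ↦ ?_⟩
  have hexp0 : 0 ≤ Real.pi * Real.exp (4 * u) := by positivity
  rcases le_or_gt u R₀ with h | h
  · have h1 : t * u ^ 2 ≤ |t| * R₀ ^ 2 := by
      calc t * u ^ 2 ≤ |t| * u ^ 2 := mul_le_mul_of_nonneg_right (le_abs_self t) (sq_nonneg u)
        _ ≤ |t| * R₀ ^ 2 := by gcongr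
    have h2 : u ^ 3 ≤ R₀ ^ 3 := by gcongr
    nlinarith
  · have hu1 : 1 ≤ u := hR₀1.trans h.le
    -- `e^{4u} ≥ (4u)^4 / 4! ≥ 10 u^4`
    have hexp : 10 * u ^ 4 ≤ Real.exp (4 * u) := by
      have h4 := Real.pow_div_factorial_le_exp (x := 4 * u) (by linarith) 4
      have hf : (Nat.factorial 4 : ℝ) = 24 := by norm_num [Nat.factorial]
      rw [hf, div_le_iff₀ (by norm_num : (0 : ℝ) < 24)] at h4
      nlinarith [pow_nonneg hu 4]
    have hu4 : R₀ * u ^ 3 ≤ u ^ 4 := by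
      rw [pow_succ u 3]
      nlinarith [pow_nonneg hu 3]
    have h3 : |t| * u ^ 2 ≤ |t| * u ^ 3 := by
      apply mul_le_mul_of_nonneg_left _ (abs_nonneg t)
      calc u ^ 2 = u ^ 2 * 1 := (mul_one _).symm
        _ ≤ u ^ 2 * u := by gcongr
        _ = u ^ 3 := by ring
    have h5 : t * u ^ 2 ≤ |t| * u ^ 2 := mul_le_mul_of_nonneg_right (le_abs_self t) (sq_nonneg u)
    have h6 : u ≤ u ^ 3 := by
      calc u = u * 1 * 1 := by ring
        _ ≤ u * u * u := by gcongr
        _ = u ^ 3 := by ring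
    have hK : 0 ≤ |t| * R₀ ^ 2 + 10 * R₀ + R₀ ^ 3 := by positivity
    nlinarith [Real.pi_gt_three, Real.exp_pos (4 * u)]

/-- Decay of `F_t`: `‖F_t(s)‖ ≤ C_t e^{−|s|} e^{−|s|³}` for all real `s`. [folklore] -/
theorem exists_norm_deBruijnKernel_le (t : ℝ) :
    ∃ C : ℝ, 0 ≤ C ∧ ∀ s : ℝ, ‖deBruijnKernel t s‖ ≤ C * Real.exp (-|s|) * Real.exp (-|s| ^ 3) := by
  obtain ⟨K, hK⟩ := exists_deBruijnKernel_exponent_le t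
  set C₁ : ℝ := ∑' n, deBruijnPhiMajorant n with hC₁
  have hC₁0 : 0 ≤ C₁ := tsum_nonneg deBruijnPhiMajorant_nonneg
  refine ⟨C₁ * Real.exp K, by positivity, fun s ↦ ?_⟩
  rw [norm_deBruijnKernel, Newman.evenPhi]
  have hs := abs_nonneg s
  have hΦ := abs_deBruijnPhi_le hs
  rw [abs_of_pos (deBruijnPhi_pos_of_nonneg hs)] at hΦ
  calc Real.exp (t * s ^ 2) * deBruijnPhi |s|
      ≤ Real.exp (t * s ^ 2) * (C₁ * Real.exp (9 * |s| - Real.pi * Real.exp (4 * |s|))) := by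
        gcongr
    _ = C₁ * Real.exp (t * |s| ^ 2 + 9 * |s| - Real.pi * Real.exp (4 * |s|)) := by
        rw [sq_abs, add_sub_assoc, Real.exp_add]; ring
    _ ≤ C₁ * Real.exp (K - |s| - |s| ^ 3) :=
        mul_le_mul_of_nonneg_left (Real.exp_le_exp.2 (hK |s| hs)) hC₁0
    _ = C₁ * Real.exp K * Real.exp (-|s|) * Real.exp (-|s| ^ 3) := by
        rw [sub_sub, sub_eq_add_neg, Real.exp_add, neg_add, Real.exp_add]; ring

/-- `F_t` is integrable over `ℝ`. [folklore] -/
theorem integrable_deBruijnKernel (t : ℝ) : Integrable (deBruijnKernel t) := by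
  obtain ⟨C, hC, hle⟩ := exists_norm_deBruijnKernel_le t
  refine Integrable.mono' ((Literature.Analysis.Complex.DeBruijn1950.integrable_exp_neg_abs.const_mul C))
    (continuous_deBruijnKernel t).aestronglyMeasurable (Eventually.of_forall fun s ↦ ?_)
  calc ‖deBruijnKernel t s‖ ≤ C * Real.exp (-|s|) * Real.exp (-|s| ^ 3) := hle s
    _ ≤ C * Real.exp (-|s|) * 1 := by
        gcongr
        exact Real.exp_le_one_iff.2 (neg_nonpos.2 (pow_nonneg (abs_nonneg s) 3))
    _ = C * Real.exp (-|s|) := mul_one _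

/-- **de Bruijn's kernel is admissible** (the hypotheses of de Bruijn 1950, Thm. 10: integrable,
`F(−s) = F(s)^*` — here `F_t` is real and even — and `F_t(s) = O(e^{−|s|³})`).
[cite: Bruijn1950, Thm. 10] -/
theorem isAdmissible_deBruijnKernel (t : ℝ) : Literature.Analysis.Complex.DeBruijn1950.IsAdmissible (deBruijnKernel t) where
  integrable := integrable_deBruijnKernel t
  conj_symm s := by rw [deBruijnKernel_neg, deBruijnKernel, Complex.conj_ofReal]
  decay := by
    obtain ⟨C, hC, hle⟩ := exists_norm_deBruijnKernel_le t
    refine ⟨3, C, by norm_num, Eventually.of_forall fun s ↦ ?_⟩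
    calc ‖deBruijnKernel t s‖ ≤ C * Real.exp (-|s|) * Real.exp (-|s| ^ 3) := hle s
      _ ≤ C * 1 * Real.exp (-|s| ^ 3) := by
          gcongr; exact Real.exp_le_one_iff.2 (neg_nonpos.2 (abs_nonneg s))
      _ = C * Real.exp (-|s| ^ (3 : ℝ)) := by
          rw [mul_one, show (3 : ℝ) = ((3 : ℕ) : ℝ) by norm_num, Real.rpow_natCast]

/-- **`∫_ℝ F_t(s) e^{izs} ds = 2 H_t(z)`**: de Bruijn's/Rodgers–Tao's `H_t` as a trigonometric
integral (fold `ℝ` onto `(0, ∞)`; `e^{izs} + e^{−izs} = 2 cos(zs)`). [cite: RodgersTaoFMP2020, §2] -/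
theorem trigIntegral_deBruijnKernel (t : ℝ) (z : ℂ) :
    Literature.Analysis.Complex.trigIntegral (deBruijnKernel t) z = 2 * deBruijnH t z := by
  have hF := isAdmissible_deBruijnKernel t
  set k : ℝ → ℂ := fun s ↦ deBruijnKernel t s * Complex.exp (I * z * s) with hk
  have hki : Integrable k :=
    Literature.Analysis.Complex.integrable_mul_cexp_of_exp_moment hF.integrable.aestronglyMeasurable z
      (hF.integrable_norm_mul_exp ‖z‖)
  have h1 : Literature.Analysis.Complex.trigIntegral (deBruijnKernel t) z = (∫ s in Iic (0 : ℝ), k s) + ∫ s in Ioi (0 : ℝ), k s := by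
    rw [Literature.Analysis.Complex.trigIntegral, intervalIntegral.integral_Iic_add_Ioi hki.integrableOn hki.integrableOn]
  have h2 : ∫ s in Iic (0 : ℝ), k s = ∫ s in Ioi (0 : ℝ), k (-s) := by
    rw [integral_comp_neg_Ioi, neg_zero]
  have hki' : IntegrableOn (fun s ↦ k (-s)) (Ioi 0) := hki.comp_neg.integrableOn
  rw [h1, h2, ← integral_add hki' hki.integrableOn, deBruijnH_eq_integral, ← integral_const_mul]
  refine setIntegral_congr_fun measurableSet_Ioi fun s (hs : 0 < s) ↦ ?_
  have hcos : Complex.exp (I * z * ((-s : ℝ) : ℂ)) + Complex.exp (I * z * s) =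
      2 * Complex.cos (z * s) := by
    rw [Complex.two_cos]
    push_cast
    ring_nf
  simp only [hk]
  rw [deBruijnKernel_neg, ← mul_add, hcos]
  simp only [deBruijnHIntegrand, deBruijnKernel, Newman.evenPhi_of_nonneg hs.le]
  push_cast
  ring

/-- The universal factor shifts the time: `F_t(s) e^{λ²s²/2} = F_{t + λ²/2}(s)`. [folklore] -/
theorem deBruijnKernel_mul_gaussian (t lam : ℝ) :
    (fun s ↦ deBruijnKernel t s * ((Real.exp (lam ^ 2 * s ^ 2 / 2) : ℝ) : ℂ)) =
      deBruijnKernel (t + lam ^ 2 / 2) := by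
  funext s
  simp only [deBruijnKernel]
  push_cast
  rw [show ((t : ℂ) + (lam : ℂ) ^ 2 / 2) * (s : ℂ) ^ 2 =
      (t : ℂ) * (s : ℂ) ^ 2 + (lam : ℂ) ^ 2 * (s : ℂ) ^ 2 / 2 by ring, Complex.exp_add]
  ring

/-! ## de Bruijn's strip theorem for `H_t` -/

/-- **Discharge of `Literature.NumberTheory.LFunctions.de_bruijn_strip` (de Bruijn 1950, Thm. 13, strip version for `H_t`).**
If every zero of `H_t` satisfies `|Im z| ≤ Δ` (`Δ ≥ 0`), then `H_{t₂}` has only real zeros for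
every `t₂ ≥ t + Δ²/2`. Proof: `2H_t = ∫ F_t e^{izs} ds` with `F_t` admissible, and with
`λ² = 2(t₂ − t) ≥ Δ²` the universal factor `e^{λ²s²/2}` turns `F_t` into `F_{t₂}` and the strip
`Δ` into `√max(Δ² − λ², 0) = 0` (`Literature.Analysis.Complex.DeBruijn1950.rootsInStrip_gaussian`; `H_{t₂} ≢ 0` by
`exists_deBruijnH_ne_zero`). [cite: Bruijn1950, Thm. 13] -/
theorem de_bruijn_strip_holds : de_bruijn_strip := by
  intro t Δ hΔ hstrip t₂ ht₂
  have htt : t ≤ t₂ := by nlinarith [sq_nonneg Δ]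
  set lam : ℝ := Real.sqrt (2 * (t₂ - t)) with hlam
  have hlam2 : lam ^ 2 = 2 * (t₂ - t) := Real.sq_sqrt (by linarith)
  have ht₂eq : t + lam ^ 2 / 2 = t₂ := by rw [hlam2]; ring
  have hroots : Literature.Analysis.Complex.RootsInStrip (Literature.Analysis.Complex.trigIntegral (deBruijnKernel t)) Δ := by
    intro z hz
    rw [trigIntegral_deBruijnKernel] at hz
    exact hstrip z ((mul_eq_zero.1 hz).resolve_left two_ne_zero)
  have hne : ∃ z, Literature.Analysis.Complex.trigIntegral
      (fun s ↦ deBruijnKernel t s * ((Real.exp (lam ^ 2 * s ^ 2 / 2) : ℝ) : ℂ)) z ≠ 0 := by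
    obtain ⟨z, hz⟩ := exists_deBruijnH_ne_zero t₂
    refine ⟨z, ?_⟩
    rw [deBruijnKernel_mul_gaussian, ht₂eq, trigIntegral_deBruijnKernel]
    exact mul_ne_zero two_ne_zero hz
  have h := Literature.Analysis.Complex.DeBruijn1950.rootsInStrip_gaussian (isAdmissible_deBruijnKernel t) hΔ lam hroots hne
  rw [deBruijnKernel_mul_gaussian, ht₂eq] at h
  have hmax : max (Δ ^ 2 - lam ^ 2) 0 = 0 := max_eq_right (by rw [hlam2]; linarith)
  rw [hmax, Real.sqrt_zero] at h
  intro z hz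
  have := h z (by rw [trigIntegral_deBruijnKernel, hz, mul_zero])
  exact abs_nonpos_iff.1 this

/-- **Discharge of `Literature.NumberTheory.LFunctions.HasOnlyRealZeros.mono_deBruijnH`** (de Bruijn's monotonicity, Thm. 13
with `Δ = 0`): real zeros at time `t` stay real at all later times. [cite: Bruijn1950, Thm. 13] -/
theorem mono_deBruijnH_holds : HasOnlyRealZeros.mono_deBruijnH :=
  LFunctions.mono_deBruijnH_of_strip de_bruijn_strip_holds

/-- The same discharge under the fact's own name `Literature.NumberTheory.LFunctions.HasOnlyRealZeros.mono_deBruijnH`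
(`<FactName>_holds` convention). [cite: Bruijn1950, Thm. 13] -/
theorem HasOnlyRealZeros.mono_deBruijnH_holds : HasOnlyRealZeros.mono_deBruijnH :=
  Literature.NumberTheory.LFunctions.mono_deBruijnH_holds

/-- **Discharge of `Literature.NumberTheory.LFunctions.hasOnlyRealZeros_deBruijnH_one_half`** (de Bruijn's bound `Λ ≤ 1/2`:
Thm. 13 with `Δ = 1` at `t = 0`, the critical strip for `ξ`). [cite: Bruijn1950, Thm. 13] -/
theorem hasOnlyRealZeros_deBruijnH_one_half_holds : hasOnlyRealZeros_deBruijnH_one_half :=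
  LFunctions.hasOnlyRealZeros_deBruijnH_one_half_of_strip de_bruijn_strip_holds deBruijnH_zero_eq_holds

/-- **Discharge of `Literature.NumberTheory.LFunctions.exists_not_hasOnlyRealZeros_deBruijnH`** (Newman 1976, Thm. 3 proper:
some `H_t` has a non-real zero), from `NewmanProofs.lean` and Hadamard's factorisation in genus
zero (`Literature.Analysis.Complex.hadamard_genus_zero_holds`). [cite: NewmanPAMS1976, Thm. 3] -/
theorem exists_not_hasOnlyRealZeros_deBruijnH_holds : LFunctions.exists_not_hasOnlyRealZeros_deBruijnH :=
  Newman.exists_not_hasOnlyRealZeros_deBruijnH_of_hadamard Literature.Analysis.Complex.hadamard_genus_zero_holds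

/-- **Discharge of `Literature.NumberTheory.LFunctions.bddBelow_setOf_hasOnlyRealZeros`** (`Λ > −∞`; Newman 1976, Thm. 3).
[cite: NewmanPAMS1976, Thm. 3] -/
theorem bddBelow_setOf_hasOnlyRealZeros_holds : bddBelow_setOf_hasOnlyRealZeros :=
  LFunctions.bddBelow_setOf_hasOnlyRealZeros_of_exists_not LFunctions.exists_not_hasOnlyRealZeros_deBruijnH_holds
    mono_deBruijnH_holds

/-! ## Newman's characterisation of `Λ` -/

/-- **Discharge of Newman's characterisation
`Literature.NumberTheory.LFunctions.hasOnlyRealZeros_deBruijnH_iff_deBruijnNewmanConst_le`** (Newman, Proc. AMS 61 (1976),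
Thm. 3; Rodgers–Tao 2020, §1: "`H_t` has purely real zeroes if and only if `t ≥ Λ`"): for every
real `t`, `H_t` has only real zeros iff `Λ ≤ t`. Assembled by
`hasOnlyRealZeros_deBruijnH_iff_deBruijnNewmanConst_le_of_newman_of_strip` from Newman's Thm. 3
proper (`RH.exists_not_hasOnlyRealZeros_deBruijnH_holds`), de Bruijn's Thm. 13
(`de_bruijn_strip_holds`) and `H_0 = ξ(½ + iz/2)/8` (`deBruijnH_zero_eq_holds`); closedness of
`{t | H_t has only real zeros}` is Hurwitz's theorem (`EquivalentsProofs.lean`).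
[cite: NewmanPAMS1976, Thm. 3] -/
theorem hasOnlyRealZeros_deBruijnH_iff_deBruijnNewmanConst_le_holds :
    LFunctions.hasOnlyRealZeros_deBruijnH_iff_deBruijnNewmanConst_le :=
  LFunctions.hasOnlyRealZeros_deBruijnH_iff_deBruijnNewmanConst_le_of_newman_of_strip
    LFunctions.exists_not_hasOnlyRealZeros_deBruijnH_holds de_bruijn_strip_holds deBruijnH_zero_eq_holds

/-- **Discharge of `Literature.NumberTheory.LFunctions.deBruijnNewmanConst_le_iff`**: `Λ ≤ t` iff `H_{t'}` has only real zeros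
for every `t' > t` (the interim proof recorded in `DeBruijnNewman.lean`, now unconditional).
[folklore] -/
theorem deBruijnNewmanConst_le_iff_holds : deBruijnNewmanConst_le_iff := by
  intro t
  constructor
  · intro h t' ht'
    exact (LFunctions.hasOnlyRealZeros_deBruijnH_iff_deBruijnNewmanConst_le_holds t').2 (h.trans ht'.le)
  · intro h
    refine le_of_forall_gt_imp_ge_of_dense fun t' ht' ↦ ?_
    exact (LFunctions.hasOnlyRealZeros_deBruijnH_iff_deBruijnNewmanConst_le_holds t').1 (h t' ht')

/-- `Λ = min {t | H_t has only real zeros}`: the infimum is attained. [cite: NewmanPAMS1976, Thm. 3] -/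
theorem hasOnlyRealZeros_deBruijnH_deBruijnNewmanConst :
    HasOnlyRealZeros (deBruijnH deBruijnNewmanConst) :=
  (LFunctions.hasOnlyRealZeros_deBruijnH_iff_deBruijnNewmanConst_le_holds _).2 le_rfl

/-- `Λ ≤ 1/2` (de Bruijn 1950). [cite: Bruijn1950, Thm. 13] -/
theorem deBruijnNewmanConst_le_one_half : deBruijnNewmanConst ≤ 1 / 2 :=
  (LFunctions.hasOnlyRealZeros_deBruijnH_iff_deBruijnNewmanConst_le_holds _).1
    hasOnlyRealZeros_deBruijnH_one_half_holds

/-- **Discharge of `Literature.NumberTheory.LFunctions.riemannHypothesis_iff_hasOnlyRealZeros_deBruijnH_zero`**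
(`RH ↔ H_0` has only real zeros; Titchmarsh §10.1, Rodgers–Tao 2020 §1), from
`H_0 = ξ(½ + iz/2)/8` (`deBruijnH_zero_eq_holds`) via `EquivalentsProofs.lean`. [cite: Titchmarsh1986, §10.1] -/
theorem riemannHypothesis_iff_hasOnlyRealZeros_deBruijnH_zero_holds :
    riemannHypothesis_iff_hasOnlyRealZeros_deBruijnH_zero :=
  LFunctions.riemannHypothesis_iff_hasOnlyRealZeros_deBruijnH_zero_of deBruijnH_zero_eq_holds

/-- **Discharge of `Literature.NumberTheory.LFunctions.riemannHypothesis_of_hasOnlyRealZeros_deBruijnH`** (real zeros for all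
`t > 0` ⇒ RH; the assembly fact of route `RiemannHypothesis/DBN`), from `deBruijnH_zero_eq_holds`
via `EquivalentsProofs.lean` (closedness at `t = 0`, Hurwitz). [cite: NewmanPAMS1976, Thm. 3] -/
theorem riemannHypothesis_of_hasOnlyRealZeros_deBruijnH_holds :
    riemannHypothesis_of_hasOnlyRealZeros_deBruijnH :=
  LFunctions.riemannHypothesis_of_hasOnlyRealZeros_deBruijnH_of deBruijnH_zero_eq_holds

/-- **`RH ↔ Λ ≤ 0`** (de Bruijn 1950 / Newman 1976; Rodgers–Tao 2020, §1), unconditionally: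
`RH ↔ H_0` has only real zeros `↔ Λ ≤ 0`. [cite: NewmanPAMS1976, Thm. 3] -/
theorem riemannHypothesis_iff_deBruijnNewmanConst_nonpos :
    RiemannHypothesis ↔ deBruijnNewmanConst ≤ 0 :=
  Iff.trans riemannHypothesis_iff_hasOnlyRealZeros_deBruijnH_zero_holds
    (LFunctions.hasOnlyRealZeros_deBruijnH_iff_deBruijnNewmanConst_le_holds 0)

/-- **`RH ↔ Λ = 0`** given Newman's conjecture `Λ ≥ 0` in its `sInf`-free form `RH.rodgers_tao`
(Rodgers–Tao 2020, Thm. 1, a named fact). [cite: RodgersTaoFMP2020, Thm. 1] -/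
theorem riemannHypothesis_iff_deBruijnNewmanConst_eq_zero_of_rodgers_tao (h : LFunctions.rodgers_tao) :
    RiemannHypothesis ↔ deBruijnNewmanConst = 0 := by
  rw [riemannHypothesis_iff_deBruijnNewmanConst_nonpos]
  have h0 : 0 ≤ deBruijnNewmanConst := by
    by_contra hneg
    push Not at hneg
    exact h _ hneg hasOnlyRealZeros_deBruijnH_deBruijnNewmanConst
  exact ⟨fun h1 ↦ le_antisymm h1 h0, fun h1 ↦ h1.le⟩

/-- The `sInf` form of Platt–Trudgian's bound from the `sInf`-free named fact `RH.platt_trudgian`: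
`Λ ≤ 1/5` (the corollary `RH.deBruijnNewmanConst_le` of `Equivalents.lean`). [cite: PlattTrudgianBLMS2021, Cor. 2] -/
theorem deBruijnNewmanConst_le_of_platt_trudgian (h : LFunctions.platt_trudgian) :
    LFunctions.deBruijnNewmanConst_le :=
  (deBruijnNewmanConst_le_iff_holds _).2 h

/-- The `sInf` form of Rodgers–Tao's theorem from the `sInf`-free named fact `RH.rodgers_tao`:
`0 ≤ Λ` (the corollary `RH.deBruijnNewmanConst_nonneg` of `Equivalents.lean`). [cite: RodgersTaoFMP2020, Thm. 1] -/
theorem deBruijnNewmanConst_nonneg_of_rodgers_tao (h : LFunctions.rodgers_tao) :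
    LFunctions.deBruijnNewmanConst_nonneg := by
  unfold LFunctions.deBruijnNewmanConst_nonneg
  by_contra hneg
  push Not at hneg
  exact h _ hneg hasOnlyRealZeros_deBruijnH_deBruijnNewmanConst

end Literature.NumberTheory.LFunctions
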